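import Summits.BirchSwinnertonDyer.BirchSwinnertonDyer.Theorems.ByReductionTypeAtTwoAdditivePotGoodPrintTwistLowerHalf
import HarnessLib

/-!
# K4 crux `AdditiveRankZeroAtTwo` (19098), child C3″ `AdditivePotGoodLowerHalfAtTwo` (22617): C3″ BY PRINT on the
# two-parameter Adachi–Nomoto–Shii families — every global minimal model of `V^{(D)}`, `D ≡ 3 (mod 4)` square-free with
# prime factors in `S₀⁺(V)` (rectangular `V`, Thm. 4.3 (ii)) resp. `S₀(V)` (non-rectangular `V`, Thm. 4.4 (i)), for ANY
# optimal `V` of odd conductor, Manin constant `1`, good at `2`, `V[2]` irreducible, with the printed `χ₄`-datum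

Cell `bsd-2adic`, seat `bsd-2adic-k4-w2` GEN 5 (prover, explicit unit, no kit); `--supports stmt-BirchSwinnertonDyer-22617
--as helper`. HONEST FRAMING (D-0036/D-0054): conditional theorems; inputs BY NAME = Adachi–Nomoto–Shii 2026 Thm. 4.3 /
Thm. 4.4 (`AdachiNomotoShii2026.thm43_rectangular_n1` / `thm44_nonRectangular_n1`, typed as printed by the b2b-p2 seat),
modularity, GZK; DISPLAYED per-base data in the fact's currency (optimal parametrisation datum with `|c| = 1`, `x₁` with
`L(V,1) = x₁Ω⁺`, a global minimal `W4 ≅ V^{(−1)}` with `IsAlgPart V W4 (−1) x₄` and `val₂ x₄ = 1` (rectangular: printed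
`v₂(L(f,χ₄,1)/Ω_f⁻) = 0`) resp. `val₂ x₄ = 0` (non-rectangular: `v₂(L(f,χ₄,1)/Ω_f⁻) = −1`), `N` odd) and DISPLAYED kernel-side
habitat data of the base (`HasGoodReductionAtPrime 2`, `0 ≤ ord₂ j`, `¬HasCM`, `V[2]` irreducible — decidable per curve, cf.
`…PrintFamily37a1Model.lean`). The `37a1` instance (`…PrintFamily37a1.lean`) is the case where ALL displayed data are
printed in the source (ANS §1 Example, §5.2). No reading, no instrument; closes nothing at the `∀`-level; nothing booked;
BSD is not proved by any of this.

WHAT IS PROVED (0 `def`, 0 `sorry`). `twistSetting_of_primes`: an admissible finite set `Q` of odd primes `q ∤ N` with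
`a_q(V)` odd and `|D| = ∏ Q`, `D ≡ 3 (mod 4)` meets `TwistSetting N (∏Q) D 1`, `IsVm V (∏Q) 0`, `q ∈ S₀(V)`.
`lowerHalf_twist_of_thm43` (rectangular `Δ(V) > 0`, `Q ⊆ S₀⁺`: all `q ≡ 1 (mod 4)`): the printed equality clause gives
`val₂ x = min{2, 1} = 1 ≤ [Δ > 0]`; `lowerHalf_twist_of_thm44` (non-rectangular `Δ(V) < 0`, `Q ⊆ S₀`): `val₂ x =
min{min{1, 1 + val₂ x₁}, 0} ≤ 0`; in both cases the CORE (`missingLowerBoundAt_two_of_twist_algPart`) and the HABITAT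
(`habitat_smul_twist_of_good_two`) of `…PrintTwistLowerHalf.lean` yield, for every global minimal `W ≅ V^{(D)}`:
`r_an(W) = 0 ∧ Addv W 2 ∧ 0 ≤ ord₂ j(W) ∧ ¬W.HasCM ∧ Irr W 2 ∧ MissingLowerBoundAt W 2` — C3″'s binders decided and its
conclusion proved, on a two-parameter (`V`, `D`) family of ADDITIVE, POTENTIALLY GOOD, `E[2]`-IRREDUCIBLE curves.

References: [AdachiNomotoShii2026] Thm. 4.3 (ii), Thm. 4.4 (i) (arXiv:2403.11474 pp. 11–12), Thm. 2.1, §1 Example, §5;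
[Pal2012] Thm. 3.2; [BarriosEtAl2025] Thm. 5.1; [Miller2011LMS] Def. 1.1.
-/

set_option autoImplicit false
set_option linter.dupNamespace false

noncomputable section

open scoped Classical

open WeierstrassCurve Literature.NumberTheory.EllipticCurves
  Literature.NumberTheory.EllipticCurves.Rank1Residual
  Literature.NumberTheory.EllipticCurves.Rank1Residual.Typed
  Literature.NumberTheory.EllipticCurves.AdachiNomotoShii2026
  Literature.NumberTheory.EllipticCurves.ModularForms
  Literature.NumberTheory.EllipticCurves.CoatesLiTianZhai2015
  Summit.BirchSwinnertonDyer.Rank1Residual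
  Summit.BirchSwinnertonDyer.Rank1Residual.X5.O1
  Summit.BirchSwinnertonDyer.Rank1Residual.P2
  Summit.BirchSwinnertonDyer.BirchSwinnertonDyer.Theorems

namespace Summit.BirchSwinnertonDyer.BirchSwinnertonDyer.Theorems.AddPotGoodPrint

/-! ## §1 From an admissible twisting set `Q` to the setting of Thms. 4.3 / 4.4 -/

/-- **From an admissible twisting set to the setting of Thms. 4.3/4.4**: `Q` a nonempty finite set of odd primes
`q ∤ N(V)` with `a_q(V)` odd, `|D| = ∏ Q`, `D ≡ 3 (mod 4)`: then `TwistSetting N(V) (∏Q) D 1` (`∏Q` square-free, odd,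
coprime to `N`, `n = 1`), `IsVm V (∏Q) 0` (`v_m = 0`), every `q ∣ ∏Q` lies in `S₀(V)`, and `(∏Q).primeFactors = Q`.
[cite: AdachiNomotoShii2026, §3 (p. 5 L20–L22) and §4 (p. 10 L93–L110)] -/
theorem twistSetting_of_primes (V : WeierstrassCurve ℚ) [V.IsGloballyMinimal] (hN2 : ¬ 2 ∣ V.conductorNorm ℤ)
    {Q : Finset ℕ} (hQ : Q.Nonempty)
    (hS : ∀ q ∈ Q, q.Prime ∧ q ≠ 2 ∧ ¬ q ∣ V.conductorNorm ℤ ∧ ¬ (2 : ℤ) ∣ aq V q)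
    {D : ℤ} (hDm : D.natAbs = ∏ q ∈ Q, q) (hD4 : D % 4 = 3) :
    TwistSetting (V.conductorNorm ℤ) (∏ q ∈ Q, q) D 1 ∧ IsVm V (∏ q ∈ Q, q) 0 ∧
      (∀ q ∈ (∏ q ∈ Q, q).primeFactors, InS V 0 q) ∧ (∏ q ∈ Q, q).primeFactors = Q := by
  have hS1 : ∀ q ∈ Q, q.Prime := fun q hq => (hS q hq).1
  have hpf : (∏ q ∈ Q, q).primeFactors = Q := Nat.primeFactors_prod hS1
  have hodd : ∀ q ∈ Q, ¬ (2 : ℤ) ∣ aq V q - 2 := fun q hq h =>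
    (hS q hq).2.2.2 (by have := dvd_add h (dvd_refl (2 : ℤ)); simpa using this)
  have h2m : ¬ 2 ∣ ∏ q ∈ Q, q := by
    intro h
    obtain ⟨q, hq, h2⟩ := (Prime.dvd_finsetProd_iff Nat.prime_two.prime _).mp h
    exact (hS q hq).2.1 (((Nat.prime_dvd_prime_iff_eq Nat.prime_two (hS1 q hq)).mp h2).symm)
  have hInS : ∀ q ∈ (∏ q ∈ Q, q).primeFactors, InS V 0 q := by
    intro q hq
    rw [hpf] at hq
    obtain ⟨hqP, hq2, hqN, -⟩ := hS q hq
    exact ⟨hqP, hq2, hqN, fun h => hodd q hq (by rw [h]; simp), padicValInt.eq_zero_of_not_dvd (hodd q hq)⟩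
  refine ⟨⟨Literature.NumberTheory.Sieve.LcmEuler.squarefree_prod_of_primes hS1, h2m, by rw [hpf]; exact hQ, hDm,
    by rw [nOf, if_neg (by omega)], ?_, fun _ => hN2⟩, ⟨fun q hq => ⟨(hInS q hq).2.2.2.1, Nat.zero_le _⟩, ?_⟩, hInS, hpf⟩
  · exact Nat.coprime_prod_left_iff.mpr fun q hq => (Nat.Prime.coprime_iff_not_dvd (hS1 q hq)).mpr (hS q hq).2.2.1
  · obtain ⟨q₀, hq₀⟩ := hQ
    exact ⟨q₀, by rw [hpf]; exact hq₀, padicValInt.eq_zero_of_not_dvd (hodd q₀ hq₀)⟩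

/-! ## §2 RECTANGULAR bases (`Δ > 0`): Adachi–Nomoto–Shii Thm. 4.3 (ii), equality case `v₂(L(f,χ₄,1)/Ω⁻) = 0` -/

/-- **C3″ BY PRINT on the rectangular Adachi–Nomoto–Shii families (Thm. 4.3 (ii), equality case).** `V` globally minimal,
OPTIMAL with Manin constant `1` (`Dt`, `hopt`, `hc1`), `N(V)` odd, GOOD at `2` with `ord₂ j ≥ 0`, NON-CM, `V[2]` IRREDUCIBLE,
RECTANGULAR (`Δ > 0`), with `L(V,1) = x₁Ω⁺` and the `χ₄`-datum `val₂ x₄ = 1` (printed: `v₂(L(f,χ₄,1)/Ω_f⁻) = 0`); `Q` a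
nonempty finite set of primes `q ≡ 1 (mod 4)`, `q ∤ N`, `a_q(V)` odd (`S₀⁺`); `D` square-free with `|D| = ∏Q`,
`D ≡ 3 (mod 4)` (so `D = −∏Q`). Then every global minimal `W ≅ V^{(D)}` has `r_an(W) = 0`, is additive and potentially good
at `2`, non-CM, with `W[2]` irreducible, and satisfies `MissingLowerBoundAt W 2` (`ord₂ #Ш_an(W) ≤ ord₂ #Ш(W)`). The `37a1`
family (`printFamily37a1_lower`) is the instance with all base data printed.
[cite: AdachiNomotoShii2026, Thm. 4.3 (ii) (arXiv:2403.11474 p. 11 L103–L157)] [cite: Miller2011LMS, Def. 1.1] -/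
theorem lowerHalf_twist_of_thm43 (h43 : thm43_rectangular_n1) (hmod : hasEntireLFunction_rat)
    (hGZK : rank_eq_analyticRank_of_analyticRank_le_one)
    (V : WeierstrassCurve ℚ) [V.IsElliptic] [V.IsGloballyMinimal] [NeZero (V.conductorNorm ℤ)]
    (hN2 : ¬ 2 ∣ V.conductorNorm ℤ) (hgood : V.HasGoodReductionAtPrime 2) (hj : 0 ≤ padicValRat 2 V.j)
    (hcm : ¬ V.HasCM) (hirr : V.HasIrreducibleModPGaloisRep 2) (hrect : 0 < V.Δ)
    (Dt : ModularParametrizationData V (V.conductorNorm ℤ)) (hopt : Zhai2021.IsOptimalDatum V Dt)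
    (hc1 : Dt.c.natAbs = 1) (x₁ : ℚ) (hx₁ : V.entireLFunction 1 = (x₁ : ℂ) * (leastRealPeriod V : ℂ))
    (W4 : WeierstrassCurve ℚ) [W4.IsElliptic] [W4.IsGloballyMinimal]
    (hW4 : ∃ C : VariableChange ℚ, C • V.quadraticTwist (-1 : ℚ) = W4) (x₄ : ℚ) (hx₄ : IsAlgPart V W4 (-1) x₄)
    (hv₄ : val₂ x₄ = 1)
    {Q : Finset ℕ} (hQ : Q.Nonempty)
    (hS : ∀ q ∈ Q, q.Prime ∧ q % 4 = 1 ∧ ¬ q ∣ V.conductorNorm ℤ ∧ ¬ (2 : ℤ) ∣ aq V q)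
    {D : ℤ} (hsq : Squarefree D) (hDm : D.natAbs = ∏ q ∈ Q, q) (hD4 : D % 4 = 3)
    (W : WeierstrassCurve ℚ) [W.IsElliptic] [W.IsGloballyMinimal]
    (hW : ∃ C : VariableChange ℚ, C • V.quadraticTwist (D : ℚ) = W) :
    W.analyticRank = 0 ∧ Addv W 2 ∧ 0 ≤ padicValRat 2 W.j ∧ ¬ W.HasCM ∧ Irr W 2 ∧ MissingLowerBoundAt W 2 := by
  obtain ⟨hTS, hVm, hInS, hpf⟩ := twistSetting_of_primes V hN2 hQ
    (fun q hq => ⟨(hS q hq).1, by have := (hS q hq).2.1; omega, (hS q hq).2.2⟩) hDm hD4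
  have hInSP : ∀ q ∈ (∏ q ∈ Q, q).primeFactors, InSPlus V 0 q := fun q hq =>
    ⟨hInS q hq, (hS q (hpf ▸ hq)).2.1⟩
  obtain ⟨-, h2⟩ := h43 V Dt hopt hc1 hrect x₁ hx₁ W4 hW4 x₄ hx₄ (∏ q ∈ Q, q) D 0 hTS hVm W hW
  obtain ⟨x, hxalg, -, heq⟩ := h2 (fun q hq => ⟨0, by norm_num, hInSP q hq⟩)
  have hvx : val₂ x = 1 := by rw [heq ⟨hv₄, hInSP⟩, hv₄]; simp [wr, δ₀, δ₂]
  have hx0 : x ≠ 0 := ne_zero_of_val₂_ne_top (by rw [hvx]; exact WithTop.coe_ne_top)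
  have hvx' : padicValRat 2 x = 1 := by
    have := hvx; rw [val₂_of_ne_zero hx0] at this; exact_mod_cast this
  obtain ⟨C, hC⟩ := hW
  obtain ⟨hr, hlow⟩ := missingLowerBoundAt_two_of_twist_algPart hmod hGZK V hirr hsq.ne_zero (by omega) W C hC x hx0
    hxalg (by rw [if_pos hrect, hvx'])
  obtain ⟨hadd, hjW, hcmW, hirrW⟩ := habitat_smul_twist_of_good_two V hgood hj hcm hirr hsq hD4 W C hC
  exact ⟨hr, hadd, hjW, hcmW, hirrW, hlow⟩

/-! ## §3 NON-RECTANGULAR bases (`Δ < 0`): Adachi–Nomoto–Shii Thm. 4.4 (i), equality case `v₂(L(f,χ₄,1)/Ω⁻) = −1` -/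

/-- **C3″ BY PRINT on the non-rectangular Adachi–Nomoto–Shii families (Thm. 4.4 (i), equality case).** As
`lowerHalf_twist_of_thm43` with `Δ(V) < 0`, the `χ₄`-datum `val₂ x₄ = 0` (printed form: `v₂(L(f,χ₄,1)/Ω_f⁻) = −1`) and
`Q` any nonempty finite set of ODD primes `q ∤ N` with `a_q(V)` odd (`S₀`, no congruence condition); `D = ±∏Q` with
`D ≡ 3 (mod 4)`. The printed equality gives `val₂ x = min{min{1, 1 + val₂ x₁}, 0} ≤ 0`, whence `L(W,1) ≠ 0` and the
lower half at every global minimal `W ≅ V^{(D)}`. [cite: AdachiNomotoShii2026, Thm. 4.4 (i) (arXiv:2403.11474 p. 12 L1–L58)] [cite: Miller2011LMS, Def. 1.1] -/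
theorem lowerHalf_twist_of_thm44 (h44 : thm44_nonRectangular_n1) (hmod : hasEntireLFunction_rat)
    (hGZK : rank_eq_analyticRank_of_analyticRank_le_one)
    (V : WeierstrassCurve ℚ) [V.IsElliptic] [V.IsGloballyMinimal] [NeZero (V.conductorNorm ℤ)]
    (hN2 : ¬ 2 ∣ V.conductorNorm ℤ) (hgood : V.HasGoodReductionAtPrime 2) (hj : 0 ≤ padicValRat 2 V.j)
    (hcm : ¬ V.HasCM) (hirr : V.HasIrreducibleModPGaloisRep 2) (hnrect : V.Δ < 0)
    (Dt : ModularParametrizationData V (V.conductorNorm ℤ)) (hopt : Zhai2021.IsOptimalDatum V Dt)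
    (hc1 : Dt.c.natAbs = 1) (x₁ : ℚ) (hx₁ : V.entireLFunction 1 = (x₁ : ℂ) * (leastRealPeriod V : ℂ))
    (W4 : WeierstrassCurve ℚ) [W4.IsElliptic] [W4.IsGloballyMinimal]
    (hW4 : ∃ C : VariableChange ℚ, C • V.quadraticTwist (-1 : ℚ) = W4) (x₄ : ℚ) (hx₄ : IsAlgPart V W4 (-1) x₄)
    (hv₄ : val₂ x₄ = 0)
    {Q : Finset ℕ} (hQ : Q.Nonempty)
    (hS : ∀ q ∈ Q, q.Prime ∧ q ≠ 2 ∧ ¬ q ∣ V.conductorNorm ℤ ∧ ¬ (2 : ℤ) ∣ aq V q)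
    {D : ℤ} (hsq : Squarefree D) (hDm : D.natAbs = ∏ q ∈ Q, q) (hD4 : D % 4 = 3)
    (W : WeierstrassCurve ℚ) [W.IsElliptic] [W.IsGloballyMinimal]
    (hW : ∃ C : VariableChange ℚ, C • V.quadraticTwist (D : ℚ) = W) :
    W.analyticRank = 0 ∧ Addv W 2 ∧ 0 ≤ padicValRat 2 W.j ∧ ¬ W.HasCM ∧ Irr W 2 ∧ MissingLowerBoundAt W 2 := by
  obtain ⟨hTS, hVm, hInS, -⟩ := twistSetting_of_primes V hN2 hQ hS hDm hD4
  obtain ⟨h1, -⟩ := h44 V Dt hopt hc1 hnrect x₁ hx₁ W4 hW4 x₄ hx₄ (∏ q ∈ Q, q) D 0 hTS hVm W hW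
  obtain ⟨x, hxalg, -, heq⟩ := h1 (fun q hq => ⟨0, by norm_num, hInS q hq⟩)
  have hvx : val₂ x ≤ 0 := by
    rw [heq ⟨hv₄, hInS⟩, hv₄]
    simp only [wr, δ₀, δ₂, if_true]
    push_cast
    simp only [zero_add, add_zero]
    exact min_le_right _ _
  have hx0 : x ≠ 0 := ne_zero_of_val₂_ne_top (ne_top_of_le_ne_top (WithTop.coe_ne_top (a := (0 : ℤ))) hvx)
  have hvx' : padicValRat 2 x ≤ 0 := by
    rw [val₂_of_ne_zero hx0] at hvx; exact_mod_cast hvx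
  obtain ⟨C, hC⟩ := hW
  obtain ⟨hr, hlow⟩ := missingLowerBoundAt_two_of_twist_algPart hmod hGZK V hirr hsq.ne_zero (by omega) W C hC x hx0
    hxalg (by rw [if_neg (not_lt.mpr hnrect.le)]; exact hvx')
  obtain ⟨hadd, hjW, hcmW, hirrW⟩ := habitat_smul_twist_of_good_two V hgood hj hcm hirr hsq hD4 W C hC
  exact ⟨hr, hadd, hjW, hcmW, hirrW, hlow⟩

end Summit.BirchSwinnertonDyer.BirchSwinnertonDyer.Theorems.AddPotGoodPrint

end
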